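import Summits.HodgeConjecture.HodgeConjecture.Theorems.F0P3InnerFormClassificationV8      -- ★ `KitFamily`, `ClassificationKit.Laws` (for `KitFamilyLaws₃`)
import Literature.NumberTheory.Rogawski1990.CohomologicalSpectrumInnerForm                -- ★ E1 `innerFormMultiplicityLeOne`, E1′ `cohFinComponentUnique_hol∕_antihol`, E2′ `hodgeTypeRigid` (the Old letters)
import Literature.NumberTheory.Automorphic.UnitaryGroupCohomologicalFormsConjRep          -- ★ `repConj`, `hasFinComponent_conj_repConj`, `cohFinComponentUnique_antihol_of_hol` (the `h2` conjugation, re-threaded in §3)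
import HarnessLib

/-!
# Crux `H413` — THREAD-₃: ONE HOME FOR THE TWO-COMPACT-PLACE LETTER TEXTS (`StubE1coh₃`, `HodgeTypeRigid₃`, `CohFinComponentUniqueHol₃ ∕ Antihol₃`, `KitFamilyLaws₃`),
# their Old → New monotones, and the E1′ conjugation `Hol₃ → Antihol₃`

Cell `hodgecm-mathlib`, crux item `stmt-HodgeConjecture-24833` (h413); R90-TF slab S5 seat R90-C133-p01 (g2), deal (H21); S5 dealer R90-C133-plan (g3) RULING S5-R20 «ONE TEXT HOME,
TWO LANES» (a) (endorsing `R90/R90-C133-p01/g2/CENSUS-L7.md` §5; default-to-file 03:15Z absent «≠» from heir LEAD F0P3a-plan (g22) ∕ director (g40)); RULING S5-R19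
«₃ twins live Summits-side» (review of p864417); heir LEAD (R-44) «THREAD-₃ ROAD»; director s2043 «THREAD-₃ REGISTRY SHAPE».  DEFINITION lane: closed-header `def … : Prop`
WITH BODIES + one-line theorems; no instance, no instance attribute, no notation, no `sorry`; never imports a `Cruxes/…/Lines` module; `--supports stmt-HodgeConjecture-24833`.
HONEST LABEL: this file asserts nothing and pays nothing; HC_CM is proved only modulo the 7 printed citations (2 remaining named inputs: hLiu418 = stmt-HodgeConjecture-24832,
h413 = stmt-HodgeConjecture-24833) until rung 0 closes.

WHY ONE HOME.  The R90-TF road pays the finite-place organ FIN of letter #80 from the Arthur-simple trace formula, which needs TWO compact real places of the definite unitary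
group — `3 ≤ [L⁺:ℚ]`.  AGG (`F0_U3LettersRung1`) does not HOLD the HJ3a line's letters E1_coh ∕ E2′ as stubs: it DERIVES them from the rung-0 rows (AGG :651 ★
`letters_of_specPkgV8W_cot`), and the rows need `stub_L3` (:582), so once `stub_S2sharp₃ ∕ stub_L3₃` carry `3 ≤` EVERY ∀-frame statement between `stub_L3` and `hJ3a_of_S345`
acquires a two-compact-place twin (≈ 10 ★ modules in two lanes, CENSUS-L7 §§1–4).  Those twins all speak about the SAME letter texts; stating each ONCE here (token for
token = the Old body + ONE inserted line `3 ≤ Module.finrank ℚ ↥(maximalRealSubfield L) →` after the kept `2 ≤ …` line — CONVENTION OF RECORD S5-R19) lets every twin, KitA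
and AGG import them BY NAME, so junctions close by name and not by ten δ-unfoldings of twenty-line copies.  PRINT-FAITHFULNESS (director s2043 (iii), verbatim): «`3 ≤ [F⁺:ℚ]`
is implied by Hyp413 (`6 ≤ [F:ℚ]`); the weakening costs nothing at the summit; anchor [Rogawski1990 §13.3 (13.3.6(c)), two compact places]» — ★
`R90.three_le_finrank_maximalRealSubfield_of_six_le` is that implication as a theorem; the `3 ≤` clause is a ROUTE restriction, NOT a hypothesis of Rogawski's theorems, which
is why these texts live here and not in `Literature/` (no cite tag on the closed-header defs, D246; the Old letters and the monotones carry the citations).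

* §1 `StubE1coh₃` (= KitA `F0_U3LettersRung1KitA` :92 `StubE1coh` body + the line; KitA cannot be imported from `Theorems`, so its `h2` text enters `stubE1coh₃_of` inline),
  `stubE1coh₃_of`, `stubE1coh₃_of_E1`; `HodgeTypeRigid₃` (= Literature `hodgeTypeRigid` :165 + the line; typ1's «`StubE2p₃`»), `hodgeTypeRigid₃_of`;
  `CohFinComponentUniqueHol₃` ∕ `CohFinComponentUniqueAntihol₃` (= Literature :115 ∕ :135 + the line), `…_of`.
* §2 `KitFamilyLaws₃ 𝔎` (= ★ V8 `KitFamily.Laws` :210 body with `3 ≤ …` after `h2`; the kit family itself and `IsPinned` need no twin — kits and pins exist at every `h2`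
  frame, only the LAWS (rows) need `h3`), `kitFamilyLaws₃_of_laws`.
* §3 `cohFinComponentUniqueAntihol₃_of_hol₃` — the E1′ conjugation (★ Literature `cohFinComponentUnique_antihol_of_hol`, same `L`, six lines) re-threaded with `h3` (CENSUS-L7 (7e)).
-/

set_option autoImplicit false
-- the mandated namespace repeats `HodgeConjecture.HodgeConjecture`, as in every `Theorems/*.lean` of this sub-problem
set_option linter.dupNamespace false

noncomputable section

open NumberField IsDedekindDomain MeasureTheory
open scoped Matrix ComplexOrder BigOperators Classical

namespace Summit.HodgeConjecture.HodgeConjecture.Cruxes.H413.F0P3ThreadLetters3Defs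

open Literature.NumberTheory.Rogawski1990 Literature.NumberTheory.GaloisRepresentations
open Literature.NumberTheory.Automorphic Literature.NumberTheory.Automorphic.UnitaryGroup
open Literature.NumberTheory.Automorphic.UnitaryGroup.CotangentForms
open Literature.RepresentationTheory.BorelWallach2000
open Literature.RepresentationTheory.KonnoKonno2007
open Summit.HodgeConjecture.HodgeConjecture.Cruxes.H413.F0P3InnerFormClassificationV6
open Summit.HodgeConjecture.HodgeConjecture.Cruxes.H413.F0P3InnerFormClassificationV6.ClassificationKit

/-! ## §1 The four letter texts, two-compact-place editions, and their Old → New -/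

/-- **E1_coh, TWO-COMPACT-PLACE EDITION `StubE1coh₃`** — KitA's `StubE1coh` (contract v4: multiplicity `≤ 1` for discrete `P` of holomorphic OR antiholomorphic cotangent type at `ι`)
body VERBATIM + ONE inserted line `3 ≤ Module.finrank ℚ ↥(maximalRealSubfield L) →` after the kept `2 ≤ …` line.  The `hE1c` hypothesis of ★ `F0P3StubS3FoldCoh3` ∕ `…S4FoldCoh3` ∕
`F0P3HJ3aOfLettersCoh3`, the `.1` of AGG's forthcoming `letters_of_rung0₃`.  Source letters: Rogawski 1990 Thm. 13.3.6 (c), Thm. 14.6.4, §15.3 ¶1 (tags on the monotones). -/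
def StubE1coh₃ : Prop :=
  ∀ (L : Type) [Field L] [NumberField L] [IsCMField L] (ι : L →+* ℂ) (H : Matrix (Fin 3) (Fin 3) L) (T : GL (Fin 3) ℂ)
    (hT : (T : Matrix (Fin 3) (Fin 3) ℂ)ᴴ * H.map ι * (T : Matrix (Fin 3) (Fin 3) ℂ) = Literature.Geometry.ComplexHyperbolic.BallModel.J),
    (∀ τ' : L →+* ℂ, InfinitePlace.mk τ' ≠ InfinitePlace.mk ι → (H.map τ').PosDef) →
    2 ≤ Module.finrank ℚ ↥(maximalRealSubfield L) →
    3 ≤ Module.finrank ℚ ↥(maximalRealSubfield L) →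
    ∀ (μ : Measure (adelicGroupData (↥(maximalRealSubfield L)) L (IsCMField.complexConj L) 3 H).automorphicQuotient)
      [(adelicGroupData (↥(maximalRealSubfield L)) L (IsCMField.complexConj L) 3 H).IsAutomorphicMeasure μ]
      (P : DiscreteAutomorphicRep (adelicGroupData (↥(maximalRealSubfield L)) L (IsCMField.complexConj L) 3 H) μ),
      (P.IsHolCotangentAt (cmArchSection L ι H T hT) (cmCompactFactor L ι H T hT) ∨
        P.IsAntiholCotangentAt (cmArchSection L ι H T hT) (cmCompactFactor L ι H T hT)) →
      ((adelicGroupData (↥(maximalRealSubfield L)) L (IsCMField.complexConj L) 3 H).rightRegular μ).multiplicity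
          P.space.toContRep ≤ 1

/-- Old → New: KitA's `StubE1coh` TEXT (inline — a `Theorems` module cannot import the Kit) implies `StubE1coh₃`. Pure logic. [cite: Rogawski1990, §14.6 Thm. 14.6.4; Thm. 13.3.6 (c)] -/
theorem stubE1coh₃_of
    (h : ∀ (L : Type) [Field L] [NumberField L] [IsCMField L] (ι : L →+* ℂ) (H : Matrix (Fin 3) (Fin 3) L) (T : GL (Fin 3) ℂ)
      (hT : (T : Matrix (Fin 3) (Fin 3) ℂ)ᴴ * H.map ι * (T : Matrix (Fin 3) (Fin 3) ℂ) = Literature.Geometry.ComplexHyperbolic.BallModel.J),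
      (∀ τ' : L →+* ℂ, InfinitePlace.mk τ' ≠ InfinitePlace.mk ι → (H.map τ').PosDef) →
      2 ≤ Module.finrank ℚ ↥(maximalRealSubfield L) →
      ∀ (μ : Measure (adelicGroupData (↥(maximalRealSubfield L)) L (IsCMField.complexConj L) 3 H).automorphicQuotient)
        [(adelicGroupData (↥(maximalRealSubfield L)) L (IsCMField.complexConj L) 3 H).IsAutomorphicMeasure μ]
        (P : DiscreteAutomorphicRep (adelicGroupData (↥(maximalRealSubfield L)) L (IsCMField.complexConj L) 3 H) μ),
        (P.IsHolCotangentAt (cmArchSection L ι H T hT) (cmCompactFactor L ι H T hT) ∨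
          P.IsAntiholCotangentAt (cmArchSection L ι H T hT) (cmCompactFactor L ι H T hT)) →
        ((adelicGroupData (↥(maximalRealSubfield L)) L (IsCMField.complexConj L) 3 H).rightRegular μ).multiplicity
            P.space.toContRep ≤ 1)
    : StubE1coh₃ :=
  fun L _ _ _ ι H T hT hdef h2 _h3 μ _ P hP => h L ι H T hT hdef h2 μ P hP

/-- E1 ★ `Rogawski1990.innerFormMultiplicityLeOne` (every discrete `P`) implies `StubE1coh₃`. [cite: Rogawski1990, §14.6 pp. 241–245: Prop. 14.6.2, Thm. 14.6.4, Thm. 14.6.5] -/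
theorem stubE1coh₃_of_E1 (h : Literature.NumberTheory.Rogawski1990.innerFormMultiplicityLeOne) : StubE1coh₃ :=
  fun L _ _ _ ι H T hT hdef h2 _h3 μ _ P _ => h L ι H T hT hdef h2 μ P

/-- **E2′, TWO-COMPACT-PLACE EDITION `HodgeTypeRigid₃`** (typ1's «`StubE2p₃`») — Literature `Rogawski1990.hodgeTypeRigid` (:165) body VERBATIM + the ONE `3 ≤ …` line: no finite
component occurs with both Hodge types, at frames with two compact places.  The `hE2'` hypothesis of ★ `F0P3StubS5Fold3` ∕ `F0P3HJ3aOfLettersCoh3`, the `.2` of `letters_of_rung0₃`. -/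
def HodgeTypeRigid₃ : Prop :=
  ∀ (L : Type) [Field L] [NumberField L] [IsCMField L] (ι : L →+* ℂ) (H : Matrix (Fin 3) (Fin 3) L) (T : GL (Fin 3) ℂ)
    (hT : (T : Matrix (Fin 3) (Fin 3) ℂ)ᴴ * H.map ι * (T : Matrix (Fin 3) (Fin 3) ℂ) = Literature.Geometry.ComplexHyperbolic.BallModel.J),
    (∀ τ' : L →+* ℂ, InfinitePlace.mk τ' ≠ InfinitePlace.mk ι → (H.map τ').PosDef) →
    2 ≤ Module.finrank ℚ ↥(maximalRealSubfield L) →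
    3 ≤ Module.finrank ℚ ↥(maximalRealSubfield L) →
    ∀ (μ : Measure (adelicGroupData (↥(maximalRealSubfield L)) L (IsCMField.complexConj L) 3 H).automorphicQuotient)
      [(adelicGroupData (↥(maximalRealSubfield L)) L (IsCMField.complexConj L) 3 H).IsAutomorphicMeasure μ]
      (W : Type) [AddCommGroup W] [Module ℂ W]
      (σ : Representation ℂ (finAdelic (↥(maximalRealSubfield L)) L (IsCMField.complexConj L) 3 H) W),
      σ.IsIrreducible → σ.IsSmooth →
    ∀ P P' : DiscreteAutomorphicRep (adelicGroupData (↥(maximalRealSubfield L)) L (IsCMField.complexConj L) 3 H) μ,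
      P.IsHolCotangentAt (cmArchSection L ι H T hT) (cmCompactFactor L ι H T hT) →
      P'.IsAntiholCotangentAt (cmArchSection L ι H T hT) (cmCompactFactor L ι H T hT) →
      P.HasFinComponent σ → P'.HasFinComponent σ → False

/-- Old → New. [cite: Rogawski1990, Thm. 13.3.6 (c); §15.3 ¶1; §12.3 p. 174; Thm. 14.6.4] -/
theorem hodgeTypeRigid₃_of (h : Literature.NumberTheory.Rogawski1990.hodgeTypeRigid) : HodgeTypeRigid₃ :=
  fun L _ _ _ ι H T hT hdef h2 _h3 μ _ W _ _ σ hσi hσs P P' hP hP' hf hf' => h L ι H T hT hdef h2 μ W σ hσi hσs P P' hP hP' hf hf'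

/-- **E1′h, TWO-COMPACT-PLACE EDITION `CohFinComponentUniqueHol₃`** — Literature `Rogawski1990.cohFinComponentUnique_hol` (:115) body VERBATIM + the ONE `3 ≤ …` line: at most one
holomorphic-type discrete `P` with a given finite component.  The `hE1'` hypothesis of ★ `F0P3StubS3FoldCoh3`, the conclusion of the forthcoming ★ `stubE1hFold_holds_coh_cpt₃`. -/
def CohFinComponentUniqueHol₃ : Prop :=
  ∀ (L : Type) [Field L] [NumberField L] [IsCMField L] (ι : L →+* ℂ) (H : Matrix (Fin 3) (Fin 3) L) (T : GL (Fin 3) ℂ)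
    (hT : (T : Matrix (Fin 3) (Fin 3) ℂ)ᴴ * H.map ι * (T : Matrix (Fin 3) (Fin 3) ℂ) = Literature.Geometry.ComplexHyperbolic.BallModel.J),
    (∀ τ' : L →+* ℂ, InfinitePlace.mk τ' ≠ InfinitePlace.mk ι → (H.map τ').PosDef) →
    2 ≤ Module.finrank ℚ ↥(maximalRealSubfield L) →
    3 ≤ Module.finrank ℚ ↥(maximalRealSubfield L) →
    ∀ (μ : Measure (adelicGroupData (↥(maximalRealSubfield L)) L (IsCMField.complexConj L) 3 H).automorphicQuotient)
      [(adelicGroupData (↥(maximalRealSubfield L)) L (IsCMField.complexConj L) 3 H).IsAutomorphicMeasure μ]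
      (W : Type) [AddCommGroup W] [Module ℂ W]
      (σ : Representation ℂ (finAdelic (↥(maximalRealSubfield L)) L (IsCMField.complexConj L) 3 H) W),
      σ.IsIrreducible → σ.IsSmooth →
    ∀ P P' : DiscreteAutomorphicRep (adelicGroupData (↥(maximalRealSubfield L)) L (IsCMField.complexConj L) 3 H) μ,
      P.IsHolCotangentAt (cmArchSection L ι H T hT) (cmCompactFactor L ι H T hT) →
      P'.IsHolCotangentAt (cmArchSection L ι H T hT) (cmCompactFactor L ι H T hT) →
      P.HasFinComponent σ → P'.HasFinComponent σ → P = P'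

/-- Old → New. [cite: Rogawski1990, §14.6 Thm. 14.6.4; §12.3 p. 174; Prop. 15.2.1 (b)] -/
theorem cohFinComponentUniqueHol₃_of (h : Literature.NumberTheory.Rogawski1990.cohFinComponentUnique_hol) : CohFinComponentUniqueHol₃ :=
  fun L _ _ _ ι H T hT hdef h2 _h3 μ _ W _ _ σ hσi hσs P P' hP hP' hf hf' => h L ι H T hT hdef h2 μ W σ hσi hσs P P' hP hP' hf hf'

/-- **E1′a, TWO-COMPACT-PLACE EDITION `CohFinComponentUniqueAntihol₃`** — Literature `Rogawski1990.cohFinComponentUnique_antihol` (:135) body VERBATIM + the ONE `3 ≤ …` line.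
The `hE1'` hypothesis of ★ `F0P3StubS4FoldCoh3`; obtained from `CohFinComponentUniqueHol₃` by conjugation (§3). -/
def CohFinComponentUniqueAntihol₃ : Prop :=
  ∀ (L : Type) [Field L] [NumberField L] [IsCMField L] (ι : L →+* ℂ) (H : Matrix (Fin 3) (Fin 3) L) (T : GL (Fin 3) ℂ)
    (hT : (T : Matrix (Fin 3) (Fin 3) ℂ)ᴴ * H.map ι * (T : Matrix (Fin 3) (Fin 3) ℂ) = Literature.Geometry.ComplexHyperbolic.BallModel.J),
    (∀ τ' : L →+* ℂ, InfinitePlace.mk τ' ≠ InfinitePlace.mk ι → (H.map τ').PosDef) →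
    2 ≤ Module.finrank ℚ ↥(maximalRealSubfield L) →
    3 ≤ Module.finrank ℚ ↥(maximalRealSubfield L) →
    ∀ (μ : Measure (adelicGroupData (↥(maximalRealSubfield L)) L (IsCMField.complexConj L) 3 H).automorphicQuotient)
      [(adelicGroupData (↥(maximalRealSubfield L)) L (IsCMField.complexConj L) 3 H).IsAutomorphicMeasure μ]
      (W : Type) [AddCommGroup W] [Module ℂ W]
      (σ : Representation ℂ (finAdelic (↥(maximalRealSubfield L)) L (IsCMField.complexConj L) 3 H) W),
      σ.IsIrreducible → σ.IsSmooth →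
    ∀ P P' : DiscreteAutomorphicRep (adelicGroupData (↥(maximalRealSubfield L)) L (IsCMField.complexConj L) 3 H) μ,
      P.IsAntiholCotangentAt (cmArchSection L ι H T hT) (cmCompactFactor L ι H T hT) →
      P'.IsAntiholCotangentAt (cmArchSection L ι H T hT) (cmCompactFactor L ι H T hT) →
      P.HasFinComponent σ → P'.HasFinComponent σ → P = P'

/-- Old → New. [cite: Rogawski1990, §14.6 Thm. 14.6.4; §12.3 p. 174; Prop. 15.2.1 (b)] -/
theorem cohFinComponentUniqueAntihol₃_of (h : Literature.NumberTheory.Rogawski1990.cohFinComponentUnique_antihol) : CohFinComponentUniqueAntihol₃ :=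
  fun L _ _ _ ι H T hT hdef h2 _h3 μ _ W _ _ σ hσi hσs P P' hP hP' hf hf' => h L ι H T hT hdef h2 μ W σ hσi hσs P P' hP hP' hf hf'

/-! ## §2 The kit-family LAWS at two-compact-place frames (E-2's hypothesis) -/

/-- **`KitFamilyLaws₃ 𝔎`** — ★ V8 `KitFamily.Laws` (:210) body with `3 ≤ Module.finrank ℚ ↥(maximalRealSubfield L) →` inserted after the `h2` binder: the family satisfies the
LAWS (for some level guard `S₀`) at every letters' frame WITH TWO COMPACT PLACES.  The kit `𝔎 L ι H T hT hdef h2 μ μω hμu hμω` itself takes no `h3` (kits and pins exist at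
every `h2` frame; only the rows — law #15 Routing comes from `stub_L3₃` — need `h3`).  Hypothesis of the forthcoming ★ `shapeGuarded₃_of_T5` ∕ `letters_of_kitFamilyOfRecordV8W₃`. -/
def KitFamilyLaws₃ (𝔎 : F0P3InnerFormClassificationV8.KitFamily) : Prop :=
  ∀ (L : Type) [Field L] [NumberField L] [IsCMField L] (ι : L →+* ℂ) (H : Matrix (Fin 3) (Fin 3) L) (T : GL (Fin 3) ℂ)
    (hT : (T : Matrix (Fin 3) (Fin 3) ℂ)ᴴ * H.map ι * (T : Matrix (Fin 3) (Fin 3) ℂ) = Literature.Geometry.ComplexHyperbolic.BallModel.J),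
    ∀ (hdef : ∀ τ' : L →+* ℂ, InfinitePlace.mk τ' ≠ InfinitePlace.mk ι → (H.map τ').PosDef)
    (h2 : 2 ≤ Module.finrank ℚ ↥(maximalRealSubfield L)), 3 ≤ Module.finrank ℚ ↥(maximalRealSubfield L) →
    ∀ (μ : Measure (adelicGroupData (↥(maximalRealSubfield L)) L (IsCMField.complexConj L) 3 H).automorphicQuotient)
    [(adelicGroupData (↥(maximalRealSubfield L)) L (IsCMField.complexConj L) 3 H).IsAutomorphicMeasure μ]
    (μω : HeckeCharacter L) (hμu : μω.IsUnitary),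
    ∀ (hμω : ∀ x : Literature.NumberTheory.GaloisRepresentations.ideleGroup ↥(maximalRealSubfield L),
      μω (AdeleRing.ideleBaseChange (↥(maximalRealSubfield L)) L x) = quadraticHeckeCharCM L x),
      ∃ S₀ : Finset (Places L), (𝔎 L ι H T hT hdef h2 μ μω hμu hμω).Laws μω hμu S₀

/-- Old → New: the `h2` laws imply the two-compact-place laws. [cite: Rogawski1990, §14.6 Thm. 14.6.4] -/
theorem kitFamilyLaws₃_of_laws (𝔎 : F0P3InnerFormClassificationV8.KitFamily) (h : F0P3InnerFormClassificationV8.KitFamily.Laws 𝔎) :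
    KitFamilyLaws₃ 𝔎 :=
  fun L _ _ _ ι H T hT hdef h2 _h3 μ _ μω hμu hμω => h L ι H T hT hdef h2 μ μω hμu hμω

/-! ## §3 E1′: holomorphic ⟹ antiholomorphic at two-compact-place frames (CENSUS-L7 (7e)) -/

section Conj

open Literature.NumberTheory.Automorphic.ConjVec

/-- **(E1′h₃) ⟹ (E1′a₃)** — ★ Literature `cohFinComponentUnique_antihol_of_hol` (:225) re-threaded with `h3`: apply the holomorphic statement at the SAME frame to the conjugates
`P̄, P̄′` (★ `isAntiholCotangentAt_iff_conj`) and `σ̄ = repConj σ` (★ `hasFinComponent_conj_repConj`), then `P ↦ P̄` is injective (★ `conj_conj`).  Feeds ★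
`F0P3HJ3aOfLettersCoh3.hJ3a_of_five_letters_coh₃`'s S4 half. [cite: BorelWallach2000, VII 2.10, 3.2] [cite: ClozelAnnArbor1990, §3.1] -/
theorem cohFinComponentUniqueAntihol₃_of_hol₃ (h : CohFinComponentUniqueHol₃) : CohFinComponentUniqueAntihol₃ := by
  intro L _ _ _ ι H T hT hpos h2 h3 μ _ W _ _ σ hirr hsm P P' hP hP' hf hf'
  have key := h L ι H T hT hpos h2 h3 μ (ConjVec W) (repConj σ) ((isIrreducible_repConj_iff σ).mpr hirr)
    ((isSmooth_repConj_iff σ).mpr hsm) P.conj P'.conj ((isAntiholCotangentAt_iff_conj P _ _).mp hP)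
    ((isAntiholCotangentAt_iff_conj P' _ _).mp hP') (hasFinComponent_conj_repConj P hf) (hasFinComponent_conj_repConj P' hf')
  rw [← P.conj_conj, key, P'.conj_conj]

end Conj

end Summit.HodgeConjecture.HodgeConjecture.Cruxes.H413.F0P3ThreadLetters3Defs

end
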